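import Summits.BirchSwinnertonDyer.BirchSwinnertonDyer.Theorems.SignedBaseChangeAnticyclotomicEisensteinDivisibilityXAcTorsionSignedCarrier
import Summits.BirchSwinnertonDyer.BirchSwinnertonDyer.Theorems.SignedBaseChangeAnticyclotomicEisensteinDivisibilityXAcTorsionSignedRank
import Summits.BirchSwinnertonDyer.BirchSwinnertonDyer.Theorems.SignedBaseChangeAnticyclotomicEisensteinDivisibilityAnticyclotomicNonsplit
import Summits.BirchSwinnertonDyer.BirchSwinnertonDyer.Theorems.UniversalToricDescentSignedSettingNoPTorsion
import Summits.BirchSwinnertonDyer.BirchSwinnertonDyer.Theorems.UniversalToricDescentTwinFullThreeAdicImageOverK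
import Summits.BirchSwinnertonDyer.BirchSwinnertonDyer.Theorems.EisensteinPrimesTwistDeformationFullAtSelmerOfFacts
import Literature.NumberTheory.EllipticCurves.AnticyclotomicSignedTransferInputs
import Literature.NumberTheory.EllipticCurves.BSDSelmerPConverseSerreProofs
import Literature.NumberTheory.EllipticCurves.ZywinaCMImageProofs
import Summits.BirchSwinnertonDyer.BirchSwinnertonDyer.Theorems.SignedBaseChangeAnticyclotomicEisensteinDivisibilityEisensteinTransfer
import Summits.BirchSwinnertonDyer.BirchSwinnertonDyer.Theorems.SignedBaseChangeAnticyclotomicEisensteinDivisibilityTransferSideInjective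
import Literature.NumberTheory.EllipticCurves.AnticyclotomicSignedSelmerRelaxedEquality
import Literature.NumberTheory.EllipticCurves.CastellaWan2024.GreenbergMainConjectureBDP
import Literature.NumberTheory.EllipticCurves.ModularCurveNonempty
import Literature.NumberTheory.EllipticCurves.CastellaHsuKunduLeeLiu2025.SignedBipartiteEulerSystem
import HarnessLib

/-!
# Line `admdef` v5/v6, cell β (C⁺⁺_NS): the Eisenstein inclusion AT A POINT from the bipartite
# non-vanishing [NV] in the typed currency of Castella–Hsu–Kundu–Lee–Liu 2025 Thm. 7.5
# (crux `AnticyclotomicEisensteinDivisibility`, stmt-BirchSwinnertonDyer-20727) — GLUE module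
# (import-independent of `…AdmdefFormTBeta`, whose rank lemma is inlined into the proof)

Lead seat bsd-line-sbc-p1 (gen 16), `--supports stmt-BirchSwinnertonDyer-20727`.  EVENT consumed: the typer
row `Literature/…/CastellaHsuKunduLeeLiu2025/SignedBipartiteEulerSystem.lean` (p725585, p726045) types
CHKLL25 Thm. 7.4 (`thm74_exists_signedBipartiteSystem`) and Thm. 7.5 = Howard 2006 Thm. 3.2.3 in the `±`
setting (`thm75_howard_rank_one_sq_le_and_le_of_hasUnitLambda`), with the criterion [NV] typed as
`SignedBipartiteSystem.HasUnitLambda` ("for some `j > 0` there exists `m ∈ 𝒩_j^def` such that `λ±_j(m)`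
has non-zero image in `Λ/𝔪`").  THIS FILE is the kernel glue that lets the line's research stub on cell β
be RESTATED in that currency:

* `exists_isCWBDPLFunction_charIdeal_map_le_of_bipartiteNV` — **the conclusion of C⁺⁺_NS at one datum
  `(p, ι, E, K, 𝔭, 𝔭̄, κ, γ, N, f)`** (a Castella–Wan BDP frame `(Ω_K ≠ 0, Ω_p, L)` with, along every
  structure map `j : ℤ_p → R₀` compatible with `ℤ_p ⊂ ℂ_p`, `∃ k, (p^k)·Ch_Λ(X_ac)·R₀⟦T⟧ ⊆ (L)`; here
  `k = 0`) **from**: the common binders (`p ≥ 5` good, `a_p = 0`, `ρ̄` onto, `K` imaginary quadratic,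
  `p ∈ 𝔭 ≠ 𝔭̄ ∋ p`, `ι` inducing `𝔭`, every `ℓ ∣ N` split, `(N, D_K) = 1`, `p ∤ h_K`, `κ` anticyclotomic,
  `f` a newform of `W` of level `N = N_E`), four PRINTED facts BY NAME — Longo–Vigni 2019 Thm. 1.4
  (`X_+` of `Λ`-rank one), Castella–Wan 2024 Lemma 6.7 (⟹ `loc_𝔭` injective on `Sel_+`, no Tamagawa
  binder, via `…TransferSideInjective`), Castella–Wan 2024 "`Sel^{+,rel} ≤ Sel_+`", and CHKLL25 Thm. 7.5 —
  and the hypothesis `hNV` = **[NV] in the typed currency**: for every non-split datum `(h𝔭, γ_𝔭, hγ_𝔭)`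
  there are a frame `(Ω_K ≠ 0, Ω_p, L)` with `IsCWBDPLFunction ι 𝔭 κ γ f D_K Ω_K Ω_p L`, a class
  `z ∈ Sel_+(K, 𝐓^ac)` with `TransferInputs … 1 z L` (Castella–Wan's inputs of the proof of Thm. 6.8 for
  `z`, `L`) and a signed bipartite system `B` of sign `+` at level `N` (`IsSignedBipartiteSystem … γ N 1 B`)
  whose limit base class is `z` (`B.IsLimitBaseClass z.1`, CHKLL25 (7.2)) and which HAS A UNIT `λ`
  (`B.HasUnitLambda N`).  Road: `Setting` from the binders; `𝔭` non-split from `p ∤ h_K`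
  (`…AnticyclotomicNonsplit`, p632042); frame, class and system from `hNV`; Thm. 7.5 with its criterion
  met (`CastellaHsuKunduLeeLiu2025.thm75_of_transferInputs`: `z` is non-torsion by Cor. 6.4 inside
  `TransferInputs`) gives the `±`-HPMC EQUALITY `char(X_{+,tors}) = ι(char(Sel_+/Λz))²`, i.e. Form T_β with
  `k = 0`; ranks and `hinj`, `hEq` from print exactly as in `…AdmdefFormTBeta.chkllPlusRatNS_of_formTBeta`
  (p724066); then the width seat's Eisenstein transfer
  `…EisensteinTransfer.TransferInputs.span_pow_mul_XAc_charIdeal_map_le_span` (p634573).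
* `XAc_charIdeal_map_le_span_of_bipartiteNV` — the same with the sharper `k`-free conclusion
  `Ch_Λ(X_ac)·R₀⟦T⟧ ⊆ (L)` recorded alongside (the equality gives no `p`-power loss).
(This module supersedes the pending proposal p728478 of the same two theorems under the namespace
`…AcDivAdmdefBipartiteNV`, which imports `…AdmdefFormTBeta` and waits on that module's hub olean; here
the rank-one argument of `…AdmdefFormTBeta.X_hasRank_sgn_one_of_longoVigni` is INLINED into the proof,
no statement is restated.)

Why [NV] is typed against the TRANSFER class and not against CHKLL25's own Thm. 7.4 system: the typed
Thm. 7.4 pins its limit base class to a Heegner family through `AcSigned.IsSignedHeegnerClass F ε z`, while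
Castella–Wan's inputs (`castellaWan2024_proofThm68_transferInputs`) pin their class existentially through
`TransferInputs ε z L`; the tree holds no bridge between the two pinnings (the printed bridge is CHKLL25
§7.2, p. 31: "(7.2) is the same as the class `κ±_∞` in (7.1)", `κ±_∞ = z^±_∞` of [CW24, §4.1]).  So the
existence of the `±` bipartite system AT the transfer class rides along inside `hNV` (it is print:
CHKLL25 Thm. 7.4 + (7.1)–(7.2) + CW24 §6), and the research content proper is `HasUnitLambda`.

All PROVED (standard axioms); no definition, no named fact, no `sorry`.  BSD / the crux / C⁺⁺_NS / [NV]
are NOT proved by this file.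
-/

-- D-0017: single-problem summit, the namespace repeats the problem name by design.
set_option linter.dupNamespace false
set_option autoImplicit false

noncomputable section

open scoped Classical NumberField

open NumberField IsDedekindDomain Field CongruenceSubgroup
  Literature.NumberTheory.EllipticCurves Literature.NumberTheory.EllipticCurves.ModularForms
  Literature.NumberTheory.EllipticCurves.Rank1Residual Literature.NumberTheory.EllipticCurves.AcSigned
  Literature.NumberTheory.EllipticCurves.Kobayashi2003 Literature.NumberTheory.EllipticCurves.CastellaWan2024
  Literature.NumberTheory.EllipticCurves.CastellaHsuKunduLeeLiu2025
  Literature.NumberTheory.GaloisRepresentations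
  Summit.BirchSwinnertonDyer.BirchSwinnertonDyer.Theorems

namespace Summit.BirchSwinnertonDyer.BirchSwinnertonDyer.Theorems.SignedBaseChangeAcDivAdmdefBipartiteNVGlue

/-! ## C⁺⁺_NS at a point from [NV] in the bipartite currency -/

variable {p : ℕ} [Fact p.Prime]

set_option maxHeartbeats 400000 in
/-- **C⁺⁺_NS AT A POINT, `k`-free, from [NV] in the bipartite currency + four printed facts.**  Given the
common binders of the line's cell-β stubs at one datum, Longo–Vigni 2019 Thm. 1.4 (`h2`), Castella–Wan 2024
Lemma 6.7 (`h67`) and "`Sel^{±,rel} ≤ Sel_±`" (`h5`), CHKLL25 Thm. 7.5 (`h75`), and `hNV` (for every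
non-split datum at `𝔭`: a Castella–Wan BDP frame `(Ω_K ≠ 0, Ω_p, L)`, a class `z ∈ Sel_+(K, 𝐓^ac)` with
`TransferInputs … 1 z L`, and a `+` bipartite system `B` at level `N` with limit base class `z` and a unit
`λ_j(m)`), there is a frame `(Ω_K ≠ 0, Ω_p, L)` with `IsCWBDPLFunction …` such that along every `j : ℤ_p →
R₀` compatible with `ℤ_p ⊂ ℂ_p`, `Ch_Λ(X_ac(E/K_∞; 𝔭̄))·R₀⟦T⟧ ⊆ (L)`.  Proof: Thm. 7.5's equality
(`thm75_of_transferInputs`) is Form T_β with `k = 0`; then the road of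
`…AdmdefFormTBeta.chkllPlusRatNS_of_formTBeta` (ranks from LV19 + Lemma 6.7, `hEq` from `h5`) and the
Eisenstein transfer `…EisensteinTransfer.TransferInputs.span_pow_mul_XAc_charIdeal_map_le_span`.
[cite: CastellaEtAl2025, Thm. 7.5 and §7.2 (7.1)–(7.2) (arXiv:2308.10474v2 p0031 L1–L30)]
[cite: CastellaWan2023, Thm. 6.8 and its proof (6.12)–(6.16), Lemma 6.7 (MS pp. 28–31)] [cite: LongoVigni2019, Thm. 1.4] -/
theorem XAc_charIdeal_map_le_span_of_bipartiteNV
    (h2 : ∀ (W : WeierstrassCurve ℚ) [W.IsGloballyMinimal] (K : Type) [Field K] [NumberField K]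
      (p : ℕ) [Fact p.Prime] (κ : ZpExtension K p) (𝔭 𝔭' : HeightOneSpectrum (𝓞 K)),
      longoVigni2019_thm14_signedSelmerDual_rank_one W K p κ 𝔭 𝔭')
    (h67 : ∀ (N : ℕ) [NeZero N] (W : WeierstrassCurve ℚ) [W.IsGloballyMinimal] (K : Type) [Field K] [NumberField K]
      (p : ℕ) [Fact p.Prime] (κ : ZpExtension K p) (𝔭 𝔭' : HeightOneSpectrum (𝓞 K)),
      castellaWan2024_lemma67_finrank_torsionCharIdeal N W K p κ 𝔭 𝔭')
    (h5 : ∀ (N : ℕ) [NeZero N] (W : WeierstrassCurve ℚ) [W.IsGloballyMinimal] (K : Type) [Field K] [NumberField K]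
      (p : ℕ) [Fact p.Prime] (κ : ZpExtension K p) (𝔭 𝔭' : HeightOneSpectrum (𝓞 K)),
      castellaWan2024_proofThm68_selmerRel_le_selmerSgn N W K p κ 𝔭 𝔭')
    (h75 : ∀ (N : ℕ) [NeZero N] (W : WeierstrassCurve ℚ) [W.IsGloballyMinimal] (K : Type) [Field K] [NumberField K]
      (p : ℕ) [Fact p.Prime] (κ : ZpExtension K p) (𝔭 𝔭' : HeightOneSpectrum (𝓞 K)),
      thm75_howard_rank_one_sq_le_and_le_of_hasUnitLambda N W K p κ 𝔭 𝔭')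
    (ι : PadicAlgCl p ≃+* ℂ) (W : WeierstrassCurve ℚ) [W.IsElliptic] [W.IsGloballyMinimal]
    (K : Type) [Field K] [NumberField K] (𝔭 𝔭bar : HeightOneSpectrum (𝓞 K)) (κ : ZpExtension K p)
    (γ : absoluteGaloisGroup K) [hγF : Fact (κ.IsTopGenerator γ)] {N : ℕ} [NeZero N]
    {f : CuspForm (Gamma0 N) 2} (hf : IsNewformOf W f) (hN : (N : ℤ) = W.conductorNorm ℤ) (hp : 5 ≤ p)
    (hgood : W.HasGoodReductionAtPrime p) (hap : W.frobeniusTrace p = 0) (hsurj : Surj W p)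
    (hK : IsImaginaryQuadratic K) (h𝔭 : ((p : ℕ) : 𝓞 K) ∈ 𝔭.asIdeal)
    (hι : ∀ (w : InfinitePlace K) (k : 𝓞 K), k ∈ 𝔭.asIdeal ↔ ‖ι.symm (w.embedding (k : K))‖ < 1)
    (h𝔭bar : ((p : ℕ) : 𝓞 K) ∈ 𝔭bar.asIdeal) (hne : 𝔭bar ≠ 𝔭)
    (hHeeg : ∀ ℓ : ℕ, ℓ.Prime → ℓ ∣ N → ((Ideal.span {(ℓ : ℤ)}).primesOver (𝓞 K)).ncard = 2)
    (hcop : IsCoprime (N : ℤ) (NumberField.discr K)) (hh : ¬ p ∣ NumberField.classNumber K)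
    (hac : κ.IsAnticyclotomic)
    (hNV : ∀ (h𝔭ns : IsNonsplitIn κ 𝔭) (γ𝔭 : absoluteGaloisGroup (𝔭.adicCompletion K))
      (hγ𝔭 : κ (resGalOfEmb (closureEmb (K := K) (𝔭.adicCompletion K)) γ𝔭) = κ γ),
      ∃ (ΩK : ℂ) (Ωp : (unrIntegers p)ˣ) (L : UnrSeries p), ΩK ≠ 0 ∧
        IsCWBDPLFunction ι 𝔭 κ γ f (NumberField.discr K) ΩK ((Ωp : unrIntegers p) : ℂ_[p]) L ∧
        ∃ (z : selmerLambdaAdic (W.baseChange K) p κ γ (fun _ ↦ .sgn 1))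
          (B : SignedBipartiteSystem W K p κ),
          TransferInputs (W.baseChange K) p κ γ hγF.out 𝔭 h𝔭ns γ𝔭 hγ𝔭 𝔭bar (fun h ↦ hne h.symm) h𝔭 1 z L ∧
          IsSignedBipartiteSystem W K p κ γ N 1 B ∧ B.IsLimitBaseClass z.1 ∧ B.HasUnitLambda N) :
    ∃ (ΩK : ℂ) (Ωp : (unrIntegers p)ˣ) (L : UnrSeries p),
      ΩK ≠ 0 ∧
      IsCWBDPLFunction ι 𝔭 κ γ f (NumberField.discr K) ΩK ((Ωp : unrIntegers p) : ℂ_[p]) L ∧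
      ∀ (j : ℤ_[p] →+* unrIntegers p),
        (∀ x : ℤ_[p], ((j x : unrIntegers p) : ℂ_[p]) = algebraMap ℚ_[p] ℂ_[p] (x : ℚ_[p])) →
        (Castella2018.AcSelmer.XAc.charIdeal (W.baseChange K) p κ 𝔭bar ∅ γ).map (PowerSeries.map j) ≤
          Ideal.span {L} := by
  have hprime : p.Prime := Fact.out
  have hp2 : p ≠ 2 := by omega
  have h3p : 3 < p := by omega
  have hS : Setting W K p κ 𝔭 𝔭bar :=
    { isElliptic := ‹_›
      p_ne_two := hp2
      goodSS := ⟨hgood, by rw [hap]; exact dvd_zero _⟩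
      frobeniusTrace_eq_zero := hap
      isImaginaryQuadratic := hK
      mem := h𝔭
      mem' := h𝔭bar
      ne := hne
      anticyclotomic := hac
      not_dvd_classNumber := hh }
  have hN' : (W.conductorNorm ℤ : ℕ) = N := by exact_mod_cast hN.symm
  have hHg : SatisfiesHeegnerHypothesis N K := fun ℓ hℓ hℓN ↦ hHeeg ℓ hℓ hℓN
  haveI : (W.baseChange K).IsElliptic := by rw [WeierstrassCurve.baseChange]; infer_instance
  -- `𝔭` does not split in `K_∞⁻` (from `p ∤ h_K`) and a matching local generator
  have hns : IsNonsplitIn κ 𝔭 :=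
    SignedBaseChangeAcDivAnticyclotomicNonsplit.isNonsplitIn_of_isAnticyclotomic_of_not_dvd_classNumber
      hK hp2 κ hac hh h𝔭
  obtain ⟨γ𝔭, hγ𝔭⟩ := hns (κ γ)
  -- frame, class and `+` bipartite system with a unit `λ` (the hypothesis [NV])
  obtain ⟨ΩK, Ωp, L, hΩ, hBDP, z, B, hTz, hB, hbase, hunit⟩ := hNV hns γ𝔭 hγ𝔭
  refine ⟨ΩK, Ωp, L, hΩ, hBDP, fun j hj ↦ ?_⟩
  -- ranks from print: `X_+` (LV19) and `finrank Sel_+ = 1` (CW Lemma 6.7 (1)); `hinj`, `hEq`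
  -- `X_+` of `Λ`-rank one from Longo–Vigni Thm 1.4 (conjunct 2), transported to Kim's carrier — the argument of
  -- `…AdmdefFormTBeta.X_hasRank_sgn_one_of_longoVigni`, inlined (that module's hub olean was unavailable)
  have hX : X.HasRank (W.baseChange K) p κ ∅ (fun _ ↦ .sgn 1) hγF.out 1 := by
    have hS' : Setting W K p κ 𝔭bar 𝔭 :=
      ⟨inferInstance, hS.p_ne_two, hS.goodSS, hS.frobeniusTrace_eq_zero, hS.isImaginaryQuadratic, hS.mem', hS.mem,
        fun h ↦ hS.ne h.symm, hS.anticyclotomic, hS.not_dvd_classNumber⟩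
    have h3N : 3 < N := by
      by_contra hle
      push Not at hle
      have hN0 : N ≠ 0 := NeZero.ne N
      have hmem : N ∈ ({1, 2, 3, 4, 5, 6, 7, 8, 9, 10, 12, 13, 16, 18, 25} : Finset ℕ) := by
        interval_cases N <;> simp_all
      exact (ModularParametrizationData_isEmpty_of_mem_genusZeroLevels W N hmem).false
        (Literature.NumberTheory.Automorphic.nonempty_modularParametrizationData_of_isNewformOf hf).some
    have hCM : ¬ W.HasCM := fun hCM ↦ W.not_hasSurjectiveModNGaloisRep_of_hasCM hCM hprime hp2 hsurj
    have hbig : ∀ u : Module.End ℤ_[p] (W.tateModule p), IsUnit u → u ∈ Set.range (W.galoisRepTate p) :=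
      fun u hu ↦ ThreeAdicImageOverK.mem_range_galoisRepTate_of_forall_hasSurjectiveModNGaloisRep W p
        (serre_hasSurjectiveModNGaloisRep_pow_holds W p hp hsurj) u hu
    have hNT : ∀ w : HeightOneSpectrum (𝓞 K), ((p : ℕ) : 𝓞 K) ∈ w.asIdeal →
        FixedPoints.addSubgroup ↥(GreenbergSelmer.decomp w ⊓ κ.kerSubgroup)
          ((W.baseChange K).geomPrimaryTorsion p) = ⊥ := by
      intro w hw
      rcases GreenbergFullAtSelmer.eq_or_eq_of_natCast_mem_of_ne hS.isImaginaryQuadratic.1 hS.mem hS.mem'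
        hS.ne hw with rfl | rfl
      · exact UniversalToricDescentSignedSetting.fixedPoints_decomp_inf_kerSubgroup_geomPrimaryTorsion_eq_bot_of_setting
          W K p κ _ 𝔭bar hS
      · exact UniversalToricDescentSignedSetting.fixedPoints_decomp_inf_kerSubgroup_geomPrimaryTorsion_eq_bot_of_setting
          W K p κ _ 𝔭 hS'
    have heq := SignedBaseChangeAcDivXAcTorsionCarrier.selmer_sgn_eq_signedSelmerInfty (W.baseChange K) κ hp2 1 hNT
    have hD := h2 W K p κ 𝔭 𝔭bar hS N hN' h3N hHg hp hCM hbig γ hγF.out 1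
      (signedSelmerDualData (W.baseChange K) κ 1 hγF.out)
    exact SignedBaseChangeAcDivXAcTorsionCarrier.X.hasRank_sgn_of_signedSelmerDual (W.baseChange K) p κ hγF.out 1 heq hD
  have hfin : (letI := selmerLambdaAdic.moduleOfGen (W.baseChange K) p κ γ hγF.out (fun _ ↦ PCond.sgn 1)
      Module.finrank (IwasawaAlgebra p) (selmerLambdaAdic (W.baseChange K) p κ γ (fun _ ↦ .sgn 1))) = 1 :=
    SignedBaseChangeAcDivTransferSideInjective.finrank_selmerLambdaAdic_sgn_eq_one_of_lemma67
      (h67 N W K p κ 𝔭 𝔭bar) hS hN' hHg h3p hγF.out 1 hX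
  have hinj := SignedBaseChangeAcDivTransferSideInjective.locSignedAt_injective_of_lemma67
    (h67 N W K p κ 𝔭 𝔭bar) hS hN' hHg h3p hTz hX
  have hRel := h5 N W K p κ 𝔭 𝔭bar hS ι hf hN' hHg h3p hι γ hγF.out 1 hfin hX
  have hEq : ∀ x' : selmerLambdaAdic (W.baseChange K) p κ γ (PCond.at 𝔭bar .rel (.sgn 1)),
      ∃ x : selmerLambdaAdic (W.baseChange K) p κ γ (fun _ ↦ .sgn 1),
        locSignedAt (W.baseChange K) p κ 𝔭 hns γ γ𝔭 hγ𝔭 (fun _ ↦ .sgn 1) 1 rfl h𝔭 x =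
          locSignedAt (W.baseChange K) p κ 𝔭 hns γ γ𝔭 hγ𝔭 (PCond.at 𝔭bar .rel (.sgn 1)) 1
            (PCond.at_of_ne .rel (.sgn 1) (fun h ↦ hne h.symm)) h𝔭 x' :=
    fun x' ↦ ⟨⟨x'.1, hRel x'.2⟩, Subtype.ext rfl⟩
  -- CHKLL25 Thm. 7.5 with its criterion met: the `±`-HPMC EQUALITY for `z` (Form T_β with `k = 0`)
  have h75z := thm75_of_transferInputs (h75 N W K p κ 𝔭 𝔭bar) hS hN' hHg hcop hp hsurj hTz hB hbase
  have heq : X.torsionCharIdeal (W.baseChange K) p κ ∅ (fun _ ↦ .sgn 1) hγF.out =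
      (signedHeegnerCharIdeal hγF.out 1 z).map (IwasawaAlgebra.invol p) ^ 2 := h75z.2 hunit
  have hk : Ideal.span {((p : ℕ) : IwasawaAlgebra p) ^ 0} *
      X.torsionCharIdeal (W.baseChange K) p κ ∅ (fun _ ↦ .sgn 1) hγF.out ≤
      (signedHeegnerCharIdeal hγF.out 1 z).map (IwasawaAlgebra.invol p) ^ 2 := by
    rw [pow_zero, Ideal.span_singleton_one, Ideal.top_mul]
    exact heq.le
  have hle := SignedBaseChangeAcDivEisensteinTransfer.TransferInputs.span_pow_mul_XAc_charIdeal_map_le_span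
    hTz h𝔭bar hinj hX hEq hk j hj
  rwa [pow_zero, Ideal.span_singleton_one, Ideal.top_mul] at hle

/-- **C⁺⁺_NS AT A POINT from [NV] in the bipartite currency** — the conclusion in the EXACT shape of the
line's registered research texts (`AdmdefLine.CHKLLPlusRatNS…`: `∃ k, span{C(p^k)} * Ch_Λ(X_ac)·R₀⟦T⟧ ≤
span{L}`; here `k = 0`), from `XAc_charIdeal_map_le_span_of_bipartiteNV`.  This is the lemma the skeleton
`Lines/admdef.lean` v5 applies to derive its cell-β C⁺⁺_NS texts from the restated stubs
`stub_bipartiteNV_twoMult` / `stub_bipartiteNV_leOneMult`. [cite: CastellaEtAl2025, Thm. 7.5 (arXiv:2308.10474v2 p0031 L13–L30)]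
[cite: CastellaWan2023, Thm. 6.8 (MS pp. 29–31)] -/
theorem exists_isCWBDPLFunction_charIdeal_map_le_of_bipartiteNV
    (h2 : ∀ (W : WeierstrassCurve ℚ) [W.IsGloballyMinimal] (K : Type) [Field K] [NumberField K]
      (p : ℕ) [Fact p.Prime] (κ : ZpExtension K p) (𝔭 𝔭' : HeightOneSpectrum (𝓞 K)),
      longoVigni2019_thm14_signedSelmerDual_rank_one W K p κ 𝔭 𝔭')
    (h67 : ∀ (N : ℕ) [NeZero N] (W : WeierstrassCurve ℚ) [W.IsGloballyMinimal] (K : Type) [Field K] [NumberField K]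
      (p : ℕ) [Fact p.Prime] (κ : ZpExtension K p) (𝔭 𝔭' : HeightOneSpectrum (𝓞 K)),
      castellaWan2024_lemma67_finrank_torsionCharIdeal N W K p κ 𝔭 𝔭')
    (h5 : ∀ (N : ℕ) [NeZero N] (W : WeierstrassCurve ℚ) [W.IsGloballyMinimal] (K : Type) [Field K] [NumberField K]
      (p : ℕ) [Fact p.Prime] (κ : ZpExtension K p) (𝔭 𝔭' : HeightOneSpectrum (𝓞 K)),
      castellaWan2024_proofThm68_selmerRel_le_selmerSgn N W K p κ 𝔭 𝔭')
    (h75 : ∀ (N : ℕ) [NeZero N] (W : WeierstrassCurve ℚ) [W.IsGloballyMinimal] (K : Type) [Field K] [NumberField K]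
      (p : ℕ) [Fact p.Prime] (κ : ZpExtension K p) (𝔭 𝔭' : HeightOneSpectrum (𝓞 K)),
      thm75_howard_rank_one_sq_le_and_le_of_hasUnitLambda N W K p κ 𝔭 𝔭')
    (ι : PadicAlgCl p ≃+* ℂ) (W : WeierstrassCurve ℚ) [W.IsElliptic] [W.IsGloballyMinimal]
    (K : Type) [Field K] [NumberField K] (𝔭 𝔭bar : HeightOneSpectrum (𝓞 K)) (κ : ZpExtension K p)
    (γ : absoluteGaloisGroup K) [hγF : Fact (κ.IsTopGenerator γ)] {N : ℕ} [NeZero N]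
    {f : CuspForm (Gamma0 N) 2} (hf : IsNewformOf W f) (hN : (N : ℤ) = W.conductorNorm ℤ) (hp : 5 ≤ p)
    (hgood : W.HasGoodReductionAtPrime p) (hap : W.frobeniusTrace p = 0) (hsurj : Surj W p)
    (hK : IsImaginaryQuadratic K) (h𝔭 : ((p : ℕ) : 𝓞 K) ∈ 𝔭.asIdeal)
    (hι : ∀ (w : InfinitePlace K) (k : 𝓞 K), k ∈ 𝔭.asIdeal ↔ ‖ι.symm (w.embedding (k : K))‖ < 1)
    (h𝔭bar : ((p : ℕ) : 𝓞 K) ∈ 𝔭bar.asIdeal) (hne : 𝔭bar ≠ 𝔭)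
    (hHeeg : ∀ ℓ : ℕ, ℓ.Prime → ℓ ∣ N → ((Ideal.span {(ℓ : ℤ)}).primesOver (𝓞 K)).ncard = 2)
    (hcop : IsCoprime (N : ℤ) (NumberField.discr K)) (hh : ¬ p ∣ NumberField.classNumber K)
    (hac : κ.IsAnticyclotomic)
    (hNV : ∀ (h𝔭ns : IsNonsplitIn κ 𝔭) (γ𝔭 : absoluteGaloisGroup (𝔭.adicCompletion K))
      (hγ𝔭 : κ (resGalOfEmb (closureEmb (K := K) (𝔭.adicCompletion K)) γ𝔭) = κ γ),
      ∃ (ΩK : ℂ) (Ωp : (unrIntegers p)ˣ) (L : UnrSeries p), ΩK ≠ 0 ∧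
        IsCWBDPLFunction ι 𝔭 κ γ f (NumberField.discr K) ΩK ((Ωp : unrIntegers p) : ℂ_[p]) L ∧
        ∃ (z : selmerLambdaAdic (W.baseChange K) p κ γ (fun _ ↦ .sgn 1))
          (B : SignedBipartiteSystem W K p κ),
          TransferInputs (W.baseChange K) p κ γ hγF.out 𝔭 h𝔭ns γ𝔭 hγ𝔭 𝔭bar (fun h ↦ hne h.symm) h𝔭 1 z L ∧
          IsSignedBipartiteSystem W K p κ γ N 1 B ∧ B.IsLimitBaseClass z.1 ∧ B.HasUnitLambda N) :
    ∃ (ΩK : ℂ) (Ωp : (unrIntegers p)ˣ) (L : UnrSeries p),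
      ΩK ≠ 0 ∧
      IsCWBDPLFunction ι 𝔭 κ γ f (NumberField.discr K) ΩK ((Ωp : unrIntegers p) : ℂ_[p]) L ∧
      ∀ (j : ℤ_[p] →+* unrIntegers p),
        (∀ x : ℤ_[p], ((j x : unrIntegers p) : ℂ_[p]) = algebraMap ℚ_[p] ℂ_[p] (x : ℚ_[p])) →
        ∃ k : ℕ,
          Ideal.span {PowerSeries.C ((p : unrIntegers p) ^ k)} *
              (Castella2018.AcSelmer.XAc.charIdeal (W.baseChange K) p κ 𝔭bar ∅ γ).map (PowerSeries.map j) ≤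
            Ideal.span {L} := by
  obtain ⟨ΩK, Ωp, L, hΩ, hBDP, hle⟩ := XAc_charIdeal_map_le_span_of_bipartiteNV h2 h67 h5 h75 ι W K 𝔭 𝔭bar
    κ γ hf hN hp hgood hap hsurj hK h𝔭 hι h𝔭bar hne hHeeg hcop hh hac hNV
  refine ⟨ΩK, Ωp, L, hΩ, hBDP, fun j hj ↦ ⟨0, ?_⟩⟩
  rw [pow_zero, map_one, Ideal.span_singleton_one, Ideal.top_mul]
  exact hle j hj

end Summit.BirchSwinnertonDyer.BirchSwinnertonDyer.Theorems.SignedBaseChangeAcDivAdmdefBipartiteNVGlue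

end
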